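import Summits.Ventures.PercRepro.C025ProfileGirthSuccSuccParts
import Summits.Ventures.PercRepro.C025ProfileGirthHallSuccA

/-!
# THE ROW `(q, q+2)` AT GIRTH `≥ q+1` — COUNTING THE PAIR SETS OF A FAT SET (night-3 g20)

For a rank-`q` set `X ⊆ E` with `p = ρ(E ∖ X)`, a basis `Z` of `E ∖ X` has `s ≥ p − q` points `Z'` outside `cl X`
(`card_filter_mem_closure_le`), and `X ∪ Z'` spans the matroid (`rkN_union_filter_notMem_closure`), so `s ≥ 3` at rank
`≥ q + 3`.  Two points `y, y'` of `Z'` are PARALLEL OVER `X` when `y' ∈ cl(X ∪ y)`; a non-parallel pair is a pair set of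
`X` (`pair_mem_of_notMem_closure_insert`).  Two counts:
* **`mul_le_two_mul_card_pairs`** — `s (s − q − 1) ≤ 2 · #{pair sets}`: every point has at most `q` parallel partners
  (an independent subset of the rank-`(q+1)` set `X ∪ y`), and the ordered non-parallel pairs map at most two-to-one
  onto the pair sets;
* **`card_sub_one_le_card_pairs`** — `s − 1 ≤ #{pair sets}`: with two non-parallel points `z₁, z₂` of `Z'`, every other
  point is non-parallel to one of them (a point in both `cl(X ∪ z₁)` and `cl(X ∪ z₂)` would put `z₂ ∈ cl(X ∪ z₁)` by the
  exchange property), giving `s − 2` pair sets `{y, z_i}` plus `{z₁, z₂}`.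
Companion modules: `C025ProfileGirthSuccSuccPairInj` (injectivity) and `C025ProfileGirthSuccSuccFat` (T3 and the row
from (T2′)).  No `def`, no `instance`, no notation.  Axioms: standard.
-/

open scoped Matroid

namespace PercRepro

open Set Finset ThmH Staged

namespace GirthRows

variable {α : Type} [DecidableEq α] {M : Matroid α} [M.Finite]

/-- A basis of `E ∖ X` as a finset: `Z ⊆ E ∖ X`, independent, of `ρ(E ∖ X)` points, with `cl Z = cl(E ∖ X)`. -/
theorem exists_basis_finset_sdiff (X : Finset α) :
    ∃ Z : Finset α, Z ⊆ gr M \ X ∧ M.Indep (Z : Set α) ∧ Z.card = rkN M (gr M \ X) ∧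
      M.closure (Z : Set α) = M.closure ((gr M \ X : Finset α) : Set α) := by
  have hE : ((gr M \ X : Finset α) : Set α) ⊆ M.E := by
    rw [← coe_gr]
    exact_mod_cast (Finset.sdiff_subset : gr M \ X ⊆ gr M)
  obtain ⟨I, hI⟩ := M.exists_isBasis ((gr M \ X : Finset α) : Set α) hE
  have hfin : I.Finite := M.ground_finite.subset hI.indep.subset_ground
  refine ⟨hfin.toFinset, ?_, ?_, ?_, ?_⟩
  · intro z hz
    rw [Set.Finite.mem_toFinset] at hz
    exact Finset.mem_coe.1 (hI.subset hz)
  · rw [Set.Finite.coe_toFinset]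
    exact hI.indep
  · have h1 := hI.encard_eq_eRk
    rw [← Set.Finite.coe_toFinset hfin, Set.encard_coe_eq_coe_finsetCard, ← Staged.coe_rkN] at h1
    exact_mod_cast h1
  · rw [Set.Finite.coe_toFinset]
    exact hI.closure_eq_closure

omit [DecidableEq α] in
open scoped Classical in
/-- An independent finset meets the closure of `A` in at most `ρ(A)` points. -/
theorem card_filter_mem_closure_le {Z A : Finset α} (hZ : M.Indep (Z : Set α)) :
    (Z.filter (fun z => z ∈ M.closure (A : Set α))).card ≤ rkN M A := by
  have hsub : ((Z.filter (fun z => z ∈ M.closure (A : Set α)) : Finset α) : Set α) ⊆ M.closure (A : Set α) := by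
    intro z hz
    rw [Finset.mem_coe, Finset.mem_filter] at hz
    exact hz.2
  have hind : M.Indep ((Z.filter (fun z => z ∈ M.closure (A : Set α)) : Finset α) : Set α) :=
    hZ.subset (Finset.coe_subset.2 (Finset.filter_subset _ _))
  have h := hind.encard_le_eRk_of_subset hsub
  rw [Matroid.eRk_closure_eq, Set.encard_coe_eq_coe_finsetCard, ← Staged.coe_rkN] at h
  exact_mod_cast h

open scoped Classical in
/-- The points of a basis of `E ∖ X` outside `cl X` span the whole matroid together with `X`. -/
theorem rkN_union_filter_notMem_closure {X Z : Finset α} (hXg : X ⊆ gr M) (hZg : Z ⊆ gr M \ X)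
    (hZcl : M.closure (Z : Set α) = M.closure ((gr M \ X : Finset α) : Set α)) :
    rkN M (X ∪ Z.filter (fun z => z ∉ M.closure (X : Set α))) = rkN M (gr M) := by
  set Z' := Z.filter (fun z => z ∉ M.closure (X : Set α)) with hZ'
  have hZ'g : Z' ⊆ gr M := (Finset.filter_subset _ _).trans (hZg.trans Finset.sdiff_subset)
  have hUg : X ∪ Z' ⊆ gr M := Finset.union_subset hXg hZ'g
  have hUE : ((X ∪ Z' : Finset α) : Set α) ⊆ M.E := by
    rw [← coe_gr]
    exact_mod_cast hUg
  have hsub : ((gr M : Finset α) : Set α) ⊆ M.closure ((X ∪ Z' : Finset α) : Set α) := by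
    have hXcl : (X : Set α) ⊆ M.closure ((X ∪ Z' : Finset α) : Set α) :=
      (Finset.coe_subset.2 Finset.subset_union_left).trans (M.subset_closure _ hUE)
    have hZcl' : (Z : Set α) ⊆ M.closure ((X ∪ Z' : Finset α) : Set α) := by
      intro z hz
      rw [Finset.mem_coe] at hz
      by_cases hzc : z ∈ M.closure (X : Set α)
      · exact M.closure_subset_closure (Finset.coe_subset.2 Finset.subset_union_left) hzc
      · have hz' : z ∈ Z' := by
          rw [hZ', Finset.mem_filter]
          exact ⟨hz, hzc⟩
        exact M.subset_closure _ hUE (Finset.mem_coe.2 (Finset.mem_union_right _ hz'))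
    have h1 : M.closure (Z : Set α) ⊆ M.closure ((X ∪ Z' : Finset α) : Set α) :=
      M.closure_subset_closure_of_subset_closure hZcl'
    rw [hZcl] at h1
    intro x hx
    by_cases hxX : x ∈ X
    · exact hXcl (Finset.mem_coe.2 hxX)
    · have hx' : x ∈ ((gr M \ X : Finset α) : Set α) := by
        rw [Finset.mem_coe, Finset.mem_sdiff]
        exact ⟨Finset.mem_coe.1 hx, hxX⟩
      have hE' : ((gr M \ X : Finset α) : Set α) ⊆ M.E := by
        rw [← coe_gr]
        exact_mod_cast (Finset.sdiff_subset : gr M \ X ⊆ gr M)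
      exact h1 (M.subset_closure _ hE' hx')
  apply le_antisymm
  · exact rkN_mono hUg
  · have h := M.eRk_mono hsub
    rw [Matroid.eRk_closure_eq, ← Staged.coe_rkN, ← Staged.coe_rkN] at h
    exact_mod_cast h

/-- A non-parallel pair of points outside `X` is a pair set of `X`: if `y, y' ∈ E ∖ X`, `y ∉ cl X` and
`y' ∉ cl(X ∪ {y})`, then `ρ(X ∪ {y, y'}) = q + 2`. -/
theorem pair_mem_of_notMem_closure_insert {q : ℕ} {X : Finset α} (hXg : X ⊆ gr M) (hXr : rkN M X = q)
    {y y' : α} (hy : y ∈ gr M \ X) (hy' : y' ∈ gr M \ X) (hyc : y ∉ M.closure (X : Set α))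
    (hy'c : y' ∉ M.closure ((insert y X : Finset α) : Set α)) :
    ({y, y'} : Finset α) ∈ ((gr M \ X).powersetCard 2).filter (fun Y => rkN M (X ∪ Y) = q + 2) := by
  have hyg : y ∈ gr M := (Finset.mem_sdiff.1 hy).1
  have hy'g : y' ∈ gr M := (Finset.mem_sdiff.1 hy').1
  have hyE : ((insert y X : Finset α) : Set α) ⊆ M.E := by
    rw [← coe_gr]
    exact_mod_cast Finset.insert_subset hyg hXg
  have hne : y ≠ y' := by
    intro h
    apply hy'c
    rw [← h]
    exact M.mem_closure_of_mem (Finset.mem_coe.2 (Finset.mem_insert_self y X)) hyE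
  rw [Finset.mem_filter, Finset.mem_powersetCard]
  refine ⟨⟨?_, Finset.card_pair hne⟩, ?_⟩
  · intro z hz
    rw [Finset.mem_insert, Finset.mem_singleton] at hz
    rcases hz with rfl | rfl
    · exact hy
    · exact hy'
  · have heq : X ∪ ({y, y'} : Finset α) = insert y' (insert y X) := by
      ext z
      simp only [Finset.mem_union, Finset.mem_insert, Finset.mem_singleton]
      tauto
    rw [heq, rkN_insert_of_notMem_closure hy'g hy'c, rkN_insert_of_notMem_closure hyg hyc, hXr]

/-- **The parallel-count bound**: with `Z'` an independent set of `s` points of `E ∖ X` outside `cl X`,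
`s (s − q − 1) ≤ 2 · #{pair sets of X}` — every point has at most `q` parallel partners. -/
theorem mul_le_two_mul_card_pairs {q : ℕ} {X Z' : Finset α} (hXg : X ⊆ gr M) (hXr : rkN M X = q)
    (hZ'g : Z' ⊆ gr M \ X) (hZ'i : M.Indep (Z' : Set α)) (hZ'c : ∀ z ∈ Z', z ∉ M.closure (X : Set α)) :
    Z'.card * (Z'.card - q - 1) ≤
      2 * (((gr M \ X).powersetCard 2).filter (fun Y => rkN M (X ∪ Y) = q + 2)).card := by
  classical
  -- the ordered non-parallel pairs
  set Ω := Z'.sigma (fun y => Z'.filter (fun y' => y' ∉ M.closure ((insert y X : Finset α) : Set α))) with hΩ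
  -- each fiber has at least `s − (q + 1)` points
  have hfib : ∀ y ∈ Z', Z'.card - (q + 1) ≤
      (Z'.filter (fun y' => y' ∉ M.closure ((insert y X : Finset α) : Set α))).card := by
    intro y hy
    have hyg : y ∈ gr M := (Finset.mem_sdiff.1 (hZ'g hy)).1
    have h1 := card_filter_mem_closure_le (A := insert y X) hZ'i
    rw [rkN_insert_of_notMem_closure hyg (hZ'c y hy), hXr] at h1
    have h2 := Finset.card_filter_add_card_filter_not
      (fun y' => y' ∈ M.closure ((insert y X : Finset α) : Set α)) (s := Z')
    omega
  have hΩcard : Z'.card * (Z'.card - q - 1) ≤ Ω.card := by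
    rw [hΩ, Finset.card_sigma]
    have : Z'.card * (Z'.card - q - 1) = ∑ _y ∈ Z', (Z'.card - (q + 1)) := by
      rw [Finset.sum_const, smul_eq_mul]
      congr 1
    rw [this]
    exact Finset.sum_le_sum hfib
  -- the map to unordered pairs is at most two-to-one
  have hmap : ∀ b ∈ Ω.image (fun a : (Σ _ : α, α) => ({a.1, a.2} : Finset α)),
      (Ω.filter (fun a : (Σ _ : α, α) => ({a.1, a.2} : Finset α) = b)).card ≤ 2 := by
    intro b hb
    rw [Finset.mem_image] at hb
    obtain ⟨a₀, ha₀, rfl⟩ := hb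
    have hsub : Ω.filter (fun a : (Σ _ : α, α) => ({a.1, a.2} : Finset α) = {a₀.1, a₀.2}) ⊆
        insert a₀ {(⟨a₀.2, a₀.1⟩ : Σ _ : α, α)} := by
      intro a ha
      rw [Finset.mem_filter] at ha
      obtain ⟨haΩ, hpair⟩ := ha
      rw [hΩ, Finset.mem_sigma, Finset.mem_filter] at haΩ
      have hne : a.1 ≠ a.2 := by
        intro h
        apply haΩ.2.2
        rw [← h]
        exact M.mem_closure_of_mem (Finset.mem_coe.2 (Finset.mem_insert_self a.1 X))
          (by rw [← coe_gr]; exact_mod_cast Finset.insert_subset ((Finset.mem_sdiff.1 (hZ'g haΩ.1)).1) hXg)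
      have h1 : a.1 ∈ ({a₀.1, a₀.2} : Finset α) := by
        rw [← hpair]
        exact Finset.mem_insert_self _ _
      have h2 : a.2 ∈ ({a₀.1, a₀.2} : Finset α) := by
        rw [← hpair]
        exact Finset.mem_insert_of_mem (Finset.mem_singleton_self _)
      rw [Finset.mem_insert, Finset.mem_singleton] at h1 h2
      rw [Finset.mem_insert, Finset.mem_singleton]
      rcases h1 with h1 | h1 <;> rcases h2 with h2 | h2
      · exact absurd (h1.trans h2.symm) hne
      · left
        exact Sigma.ext h1 (heq_of_eq h2)
      · right
        exact Sigma.ext h1 (heq_of_eq h2)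
      · exact absurd (h1.trans h2.symm) hne
    have h2 : (insert a₀ ({⟨a₀.2, a₀.1⟩} : Finset (Σ _ : α, α))).card ≤ 2 := by
      calc (insert a₀ ({⟨a₀.2, a₀.1⟩} : Finset (Σ _ : α, α))).card
          ≤ ({⟨a₀.2, a₀.1⟩} : Finset (Σ _ : α, α)).card + 1 := Finset.card_insert_le _ _
        _ = 2 := by rw [Finset.card_singleton]
    exact (Finset.card_le_card hsub).trans h2
  have hΩle := Finset.card_le_mul_card_image Ω 2 hmap
  -- the image consists of pair sets
  have himg : Ω.image (fun a : (Σ _ : α, α) => ({a.1, a.2} : Finset α)) ⊆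
      ((gr M \ X).powersetCard 2).filter (fun Y => rkN M (X ∪ Y) = q + 2) := by
    rw [Finset.image_subset_iff]
    intro a ha
    rw [hΩ, Finset.mem_sigma, Finset.mem_filter] at ha
    exact pair_mem_of_notMem_closure_insert hXg hXr (hZ'g ha.1) (hZ'g ha.2.1) (hZ'c _ ha.1) ha.2.2
  have := Finset.card_le_card himg
  omega

/-- **The two-point bound**: with `Z'` as above of `s ≥ 3` points and `ρ(X ∪ Z') ≥ q + 3`, `s − 1 ≤ #{pair sets of X}` —
every point is non-parallel to one of two fixed non-parallel points. -/
theorem card_sub_one_le_card_pairs {q : ℕ} {X Z' : Finset α} (hXg : X ⊆ gr M) (hXr : rkN M X = q)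
    (hZ'g : Z' ⊆ gr M \ X) (hZ'c : ∀ z ∈ Z', z ∉ M.closure (X : Set α)) (hs : 3 ≤ Z'.card)
    (hrk : q + 3 ≤ rkN M (X ∪ Z')) :
    Z'.card - 1 ≤ (((gr M \ X).powersetCard 2).filter (fun Y => rkN M (X ∪ Y) = q + 2)).card := by
  classical
  set PS := ((gr M \ X).powersetCard 2).filter (fun Y => rkN M (X ∪ Y) = q + 2) with hPS
  obtain ⟨z₁, hz₁⟩ : Z'.Nonempty := Finset.card_pos.1 (by omega)
  have hz₁g : z₁ ∈ gr M := (Finset.mem_sdiff.1 (hZ'g hz₁)).1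
  have hz₁E : ((insert z₁ X : Finset α) : Set α) ⊆ M.E := by
    rw [← coe_gr]
    exact_mod_cast Finset.insert_subset hz₁g hXg
  have hr1 : rkN M (insert z₁ X) = q + 1 := by
    rw [rkN_insert_of_notMem_closure hz₁g (hZ'c z₁ hz₁), hXr]
  -- a second point outside `cl(X ∪ z₁)`
  obtain ⟨z₂, hz₂, hz₂c⟩ : ∃ z₂ ∈ Z', z₂ ∉ M.closure ((insert z₁ X : Finset α) : Set α) := by
    by_contra hcon
    push Not at hcon
    have hsub : ((X ∪ Z' : Finset α) : Set α) ⊆ M.closure ((insert z₁ X : Finset α) : Set α) := by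
      intro z hz
      rw [Finset.mem_coe, Finset.mem_union] at hz
      rcases hz with hz | hz
      · exact M.mem_closure_of_mem (Finset.mem_coe.2 (Finset.mem_insert_of_mem hz)) hz₁E
      · exact hcon z hz
    have h := M.eRk_mono hsub
    rw [Matroid.eRk_closure_eq, ← Staged.coe_rkN, ← Staged.coe_rkN, hr1] at h
    have : rkN M (X ∪ Z') ≤ q + 1 := by exact_mod_cast h
    omega
  have hz₂g : z₂ ∈ gr M := (Finset.mem_sdiff.1 (hZ'g hz₂)).1
  have hne : z₁ ≠ z₂ := by
    intro h
    apply hz₂c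
    rw [← h]
    exact M.mem_closure_of_mem (Finset.mem_coe.2 (Finset.mem_insert_self z₁ X)) hz₁E
  -- a point in both `cl(X ∪ z₁)` and `cl(X ∪ z₂)` is impossible
  have hnotboth : ∀ y ∈ Z', y ∈ M.closure ((insert z₁ X : Finset α) : Set α) →
      y ∉ M.closure ((insert z₂ X : Finset α) : Set α) := by
    intro y hy hy1 hy2
    have hyc := hZ'c y hy
    have hex : y ∈ M.closure (insert z₂ (X : Set α)) \ M.closure (X : Set α) := by
      rw [← Finset.coe_insert]
      exact ⟨hy2, hyc⟩
    have h1 := (Matroid.closure_exchange hex).1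
    -- `cl(X ∪ y) ⊆ cl(X ∪ z₁)`
    have h2 : insert y (X : Set α) ⊆ M.closure ((insert z₁ X : Finset α) : Set α) := by
      intro w hw
      rcases hw with rfl | hw
      · exact hy1
      · exact M.mem_closure_of_mem (Finset.mem_coe.2 (Finset.mem_insert_of_mem (Finset.mem_coe.1 hw))) hz₁E
    have h3 := M.closure_subset_closure_of_subset_closure h2 h1
    exact hz₂c h3
  -- the injection `y ↦ {y, z_i}` on `Z' ∖ {z₁, z₂}`
  set T := Z' \ {z₁, z₂} with hT
  have hTc : T.card = Z'.card - 2 := by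
    rw [hT, Finset.card_sdiff_of_subset, Finset.card_pair hne]
    intro z hz
    rw [Finset.mem_insert, Finset.mem_singleton] at hz
    rcases hz with rfl | rfl
    · exact hz₁
    · exact hz₂
  have hmem : ∀ y ∈ T, (if y ∈ M.closure ((insert z₁ X : Finset α) : Set α) then ({y, z₂} : Finset α)
      else ({y, z₁} : Finset α)) ∈ PS := by
    intro y hy
    rw [hT, Finset.mem_sdiff] at hy
    split_ifs with hy1
    · rw [Finset.pair_comm]
      exact pair_mem_of_notMem_closure_insert hXg hXr (hZ'g hz₂) (hZ'g hy.1) (hZ'c z₂ hz₂)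
        (hnotboth y hy.1 hy1)
    · rw [Finset.pair_comm]
      exact pair_mem_of_notMem_closure_insert hXg hXr (hZ'g hz₁) (hZ'g hy.1) (hZ'c z₁ hz₁) hy1
  have hinj : Set.InjOn (fun y => if y ∈ M.closure ((insert z₁ X : Finset α) : Set α) then ({y, z₂} : Finset α)
      else ({y, z₁} : Finset α)) (T : Set (α)) := by
    intro y hy y' hy' heq
    rw [Finset.mem_coe, hT, Finset.mem_sdiff, Finset.mem_insert, Finset.mem_singleton] at hy hy'
    push Not at hy hy'
    simp only at heq
    have hmem' : y ∈ (if y' ∈ M.closure ((insert z₁ X : Finset α) : Set α) then ({y', z₂} : Finset α)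
        else ({y', z₁} : Finset α)) := by
      rw [← heq]
      split_ifs <;> exact Finset.mem_insert_self _ _
    split_ifs at hmem' <;> rw [Finset.mem_insert, Finset.mem_singleton] at hmem' <;>
      rcases hmem' with h | h
    · exact h
    · exact absurd h hy.2.2
    · exact h
    · exact absurd h hy.2.1
  have himg : T.image (fun y => if y ∈ M.closure ((insert z₁ X : Finset α) : Set α) then ({y, z₂} : Finset α)
      else ({y, z₁} : Finset α)) ⊆ PS := by
    rw [Finset.image_subset_iff]
    exact hmem
  have hz12 : ({z₁, z₂} : Finset α) ∈ PS :=
    pair_mem_of_notMem_closure_insert hXg hXr (hZ'g hz₁) (hZ'g hz₂) (hZ'c z₁ hz₁) hz₂c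
  have hz12img : ({z₁, z₂} : Finset α) ∉ T.image (fun y =>
      if y ∈ M.closure ((insert z₁ X : Finset α) : Set α) then ({y, z₂} : Finset α) else ({y, z₁} : Finset α)) := by
    rw [Finset.mem_image]
    rintro ⟨y, hy, hyeq⟩
    rw [hT, Finset.mem_sdiff, Finset.mem_insert, Finset.mem_singleton] at hy
    have hmem' : y ∈ ({z₁, z₂} : Finset α) := by
      rw [← hyeq]
      split_ifs <;> exact Finset.mem_insert_self _ _
    rw [Finset.mem_insert, Finset.mem_singleton] at hmem'
    exact hy.2 hmem'
  have hcard : (insert ({z₁, z₂} : Finset α) (T.image (fun y =>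
      if y ∈ M.closure ((insert z₁ X : Finset α) : Set α) then ({y, z₂} : Finset α)
      else ({y, z₁} : Finset α)))).card = Z'.card - 1 := by
    rw [Finset.card_insert_of_notMem hz12img, Finset.card_image_of_injOn hinj, hTc]
    omega
  have hsub : insert ({z₁, z₂} : Finset α) (T.image (fun y =>
      if y ∈ M.closure ((insert z₁ X : Finset α) : Set α) then ({y, z₂} : Finset α)
      else ({y, z₁} : Finset α))) ⊆ PS :=
    Finset.insert_subset hz12 himg
  rw [← hcard]
  exact Finset.card_le_card hsub


end GirthRows

end PercRepro
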